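/-
Copyright (c) 2026 the pub-hodgecm-mathlib formalisation cell (harness21).  Prover seat hodgecm-mathlib-F0P3a-p02 (g18): road «S3-ram», (Cnt2′) ROUTE B (chair
F0P3a-p07 (g15) RULING (17)(a)(b)): the FINITE half of the type-(2) root collar census, IV — the census at a NON-centred root, both root planes; 2026-09-02.
-/
import Literature.NumberTheory.Rogawski1990.DepthZeroKappaTransferTypeTwoRamifiedBlockRootPlaneSumsAffine   -- p849425 (this seat): (I1′)(I2′)(I4′)(I5′)
import Literature.NumberTheory.Rogawski1990.DepthZeroKappaTransferTypeTwoRamifiedBlockRootCensus            -- ★ p849375 (this seat): cone fibre, centred case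
import HarnessLib

/-!
# The type-(2) root census, IV: NULL and CLASS root lines at the root of a type-(2) literal with a NON-centred residual block — both root planes
# (Rogawski 1990 §4.9; Kottwitz 1986 §3; Lidl–Niederreiter Ch. 6 §2)

Topic `NumberTheory/Rogawski1990`; namespace `Literature.NumberTheory.Rogawski1990.TypeTwoBlockRoot` (continues ★ `…BlockRootCensus`).  THEOREMS ONLY (no definition, no
instance, no notation, no named fact, no `sorry`); kernel lane `--supports stmt-HodgeConjecture-24833` (cell `pub/hodgecm-mathlib`, crux H413, road «S3-ram», count-neutral).
Statement-first v2 `F0/P3a/F0P3a-p02/g18/census/BlockRootCensus.statementfirst.v2.F0P3ap02g18.lean` (the four heads below, verbatim); chair F0P3a-p07 (g15) RULING (17):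
(a) no centring hypothesis `B_{jj} + B_{ll} = 2B_{i₀i₀}`; (b) the null law in `χ(det B̄'_W)`-shape; (v) the class split depends on the relative scalar `b₀`.

THE MATHEMATICS (`k` finite, odd characteristic).  Frame data at the root (★ p847712's currency): `ᵗĀ·J̄₀·Ā = diag(δ)`, `Ā⁻¹·Ȳ·Ā = B` with `B` a scalar `B_{i₀i₀}` at the
isolated index and a `{j,l}`-block, `diag(δ)`-self-adjoint (`δ_jB_{jl} = δ_lB_{lj}`) with IRREDUCIBLE characteristic polynomial: `disc := (B_{jj} − B_{ll})² + 4B_{jl}B_{lj}`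
a non-square.  Put `B̄'_W := B_W − B_{i₀i₀}·1 = ((α, b), (b', γ))`, `det' := αγ − bb'`, `τ := α + γ`.  On the isotropic cone the line value `ᵗw·diag(δ)B·w` is the binary
form `T(w_j, w_l) = δ_jα w_j² + 2δ_jb w_jw_l + δ_lγ w_l²` (the scalar `B_{i₀i₀}·(cone) = 0` drops), and files I–III give:
**NULL `#{p : Q = 0} = 1 + χ(−δ_jδ_l·det')`** (`= 1 + s·χ(det')`, `s = χ(−δ_jδ_l)` the root-plane type — RULING (17)(ii)) and
**CLASS `2·#{p : χ(c₀Q) = ε} = q − χ(−δ_jδ_l·det') + ε·χ(2c₀δ_{i₀}δ_jδ_l)·J(τ, disc)`**, `J(τ, D) = Σ_v χ(v + τ)χ(v² − D)` (elliptic; `b₀`-dependent — RULING (17)(v));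
the signed class sum `#₊ − #₋ = χ(2c₀δ_{i₀}δ_jδ_l)·J(τ, disc)` is the same for two roots with the same `(τ, disc)` and the same `χ(2c₀δ_{i₀}δ_jδ_l)` — the CROSS LAW
(RULING (17)(iv)) once the lattice side identifies these.  Numerics: 353 random cases `q ≤ 13` (incl. `α = 0`) + the chair's `q = 7, 13` tables, 0 mismatch.
HONEST LABEL: HC_CM is proved only modulo the 2 remaining named inputs (hLiu418 24832, h413 24833) until rung 0 closes; finite-field algebra only, nothing printed is asserted.

## References
* [Rogawski1990] J. D. Rogawski, *Automorphic Representations of Unitary Groups in Three Variables*, Ann. of Math. Stud. 123 (1990), §4.9 Prop. 4.9.1 p. 55.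
* [Kottwitz1986] R. E. Kottwitz, *Base change for unit elements of Hecke algebras*, Compositio Math. 60 (1986), §3.
* [LidlNiederreiter1996] R. Lidl, H. Niederreiter, *Finite Fields*, 2nd ed. (1996), Def. 5.49, Thm. 6.26–6.27.
* [IrelandRosen1990] K. Ireland, M. Rosen, *A Classical Introduction to Modern Number Theory*, GTM 84, Ch. 8 §1–§3, Ch. 18 §2.
-/

set_option autoImplicit false

namespace Literature.NumberTheory.Rogawski1990.TypeTwoBlockRoot

open Finset Matrix
open Literature.NumberTheory.Automorphic Literature.NumberTheory.Automorphic.HermitianLattice Literature.NumberTheory.Automorphic.UnitaryGroup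
open Literature.LinearAlgebra.QuadraticFormCountCongruence Literature.GroupTheory.SpecificGroups
open Literature.NumberTheory.Rogawski1990

variable {k : Type*} [Field k] [Fintype k] [DecidableEq k]

/-! ## §1 The census in `k × k × k` for a general block -/

/-- **NULL LINES, `k × k × k` currency, general block: `#{v ≠ 0 : cone ∧ T(v.2) = 0} = (q − 1)·(1 + χ(δ₁δ₂(bb' − αγ)))`** (`δ`'s non-zero, `δ₁b = δ₂b'`,
`χ((α − γ)² + 4bb') = −1`): cone fibre = (I1′) + (I2′).  (Statement-first v2 head, verbatim.) [cite: Rogawski1990, §4.9 Prop. 4.9.1 p. 55] [cite: Kottwitz1986, §3] -/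
theorem card_iso_blockFrame_prod_null_eq' (hk : ringChar k ≠ 2) {δ₀ δ₁ δ₂ : k} (hδ₀ : δ₀ ≠ 0) (hδ₁ : δ₁ ≠ 0) (hδ₂ : δ₂ ≠ 0)
    {α γ b b' : k} (hbb : δ₁ * b = δ₂ * b') (hirr : quadraticChar k ((α - γ) ^ 2 + 4 * (b * b')) = -1) :
    ((univ.filter fun v : k × k × k => v ≠ 0 ∧ δ₀ * v.1 ^ 2 + δ₁ * v.2.1 ^ 2 + δ₂ * v.2.2 ^ 2 = 0 ∧
        δ₁ * α * v.2.1 ^ 2 + 2 * δ₁ * b * v.2.1 * v.2.2 + δ₂ * γ * v.2.2 ^ 2 = 0).card : ℤ) =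
      (Fintype.card k - 1) * (1 + quadraticChar k (δ₁ * δ₂ * (b * b' - α * γ))) := by
  have hm : -δ₀⁻¹ ≠ 0 := neg_ne_zero.2 (inv_ne_zero hδ₀)
  rw [card_cone_filter_eq_sum hk hδ₀ δ₁ δ₂ (fun w : k × k => δ₁ * α * w.1 ^ 2 + 2 * δ₁ * b * w.1 * w.2 + δ₂ * γ * w.2 ^ 2 = 0)]
  have hsplit : ∀ w : k × k, (if δ₁ * α * w.1 ^ 2 + 2 * δ₁ * b * w.1 * w.2 + δ₂ * γ * w.2 ^ 2 = 0 then
      (1 : ℤ) + quadraticChar k (-δ₀⁻¹ * (δ₁ * w.1 ^ 2 + δ₂ * w.2 ^ 2)) else 0) =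
      (if δ₁ * α * w.1 ^ 2 + 2 * δ₁ * b * w.1 * w.2 + δ₂ * γ * w.2 ^ 2 = 0 then (1 : ℤ) else 0) +
        (if δ₁ * α * w.1 ^ 2 + 2 * δ₁ * b * w.1 * w.2 + δ₂ * γ * w.2 ^ 2 = 0 then quadraticChar k (-δ₀⁻¹ * (δ₁ * w.1 ^ 2 + δ₂ * w.2 ^ 2)) else 0) := fun w => by
    split_ifs <;> simp
  simp_rw [hsplit]
  rw [Finset.sum_add_distrib, sum_ite_value_eq_zero_one' hk hδ₁ hδ₂ hbb hirr, sum_ite_value_eq_zero_quadraticChar_norm' hk hδ₁ hδ₂ hbb hirr hm, add_zero]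

/-- **CLASS LINES, `k × k × k` currency, general block (doubled): `2·#{v ≠ 0 : cone ∧ χ(c₀T(v.2)) = ε} = (q − 1)·(q − χ(δ₁δ₂(bb' − αγ)) + ε·χ(2c₀δ₀δ₁δ₂)·J(α + γ, disc))`**,
`J(τ,D) = Σ_v χ(v + τ)χ(v² − D)`, `disc = (α − γ)² + 4bb'` (`c₀ ≠ 0`, `ε = ±1`): `2·[χ = ε] = χ² + εχ` and the doubled count is `(q² − 1) − (I1′) + ((I3) − (I2′)) +
ε·((I4′) + (I5′))`.  (Statement-first v2 head, verbatim.) [cite: Rogawski1990, §4.9 Prop. 4.9.1 p. 55] [cite: Kottwitz1986, §3] [cite: LidlNiederreiter1996, Def. 5.49] -/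
theorem two_mul_card_iso_blockFrame_prod_quadraticChar_eq' (hk : ringChar k ≠ 2) {δ₀ δ₁ δ₂ : k} (hδ₀ : δ₀ ≠ 0) (hδ₁ : δ₁ ≠ 0) (hδ₂ : δ₂ ≠ 0)
    {α γ b b' : k} (hbb : δ₁ * b = δ₂ * b') (hirr : quadraticChar k ((α - γ) ^ 2 + 4 * (b * b')) = -1)
    {c₀ : k} (hc₀ : c₀ ≠ 0) {ε : ℤ} (hε : ε = 1 ∨ ε = -1) :
    2 * ((univ.filter fun v : k × k × k => v ≠ 0 ∧ δ₀ * v.1 ^ 2 + δ₁ * v.2.1 ^ 2 + δ₂ * v.2.2 ^ 2 = 0 ∧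
        quadraticChar k (c₀ * (δ₁ * α * v.2.1 ^ 2 + 2 * δ₁ * b * v.2.1 * v.2.2 + δ₂ * γ * v.2.2 ^ 2)) = ε).card : ℤ) =
      (Fintype.card k - 1) * (Fintype.card k - quadraticChar k (δ₁ * δ₂ * (b * b' - α * γ)) +
        ε * quadraticChar k (2 * c₀ * δ₀ * δ₁ * δ₂) * ∑ v : k, quadraticChar k (v + (α + γ)) * quadraticChar k (v ^ 2 - ((α - γ) ^ 2 + 4 * (b * b')))) := by
  have hm : -δ₀⁻¹ ≠ 0 := neg_ne_zero.2 (inv_ne_zero hδ₀)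
  rw [card_cone_filter_eq_sum hk hδ₀ δ₁ δ₂ (fun w : k × k =>
    quadraticChar k (c₀ * (δ₁ * α * w.1 ^ 2 + 2 * δ₁ * b * w.1 * w.2 + δ₂ * γ * w.2 ^ 2)) = ε), Finset.mul_sum]
  have hpt : ∀ w : k × k, 2 * (if quadraticChar k (c₀ * (δ₁ * α * w.1 ^ 2 + 2 * δ₁ * b * w.1 * w.2 + δ₂ * γ * w.2 ^ 2)) = ε then
      (1 : ℤ) + quadraticChar k (-δ₀⁻¹ * (δ₁ * w.1 ^ 2 + δ₂ * w.2 ^ 2)) else 0) =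
      ((1 - (if δ₁ * α * w.1 ^ 2 + 2 * δ₁ * b * w.1 * w.2 + δ₂ * γ * w.2 ^ 2 = 0 then (1 : ℤ) else 0)) +
        (quadraticChar k (-δ₀⁻¹ * (δ₁ * w.1 ^ 2 + δ₂ * w.2 ^ 2)) -
          (if δ₁ * α * w.1 ^ 2 + 2 * δ₁ * b * w.1 * w.2 + δ₂ * γ * w.2 ^ 2 = 0 then quadraticChar k (-δ₀⁻¹ * (δ₁ * w.1 ^ 2 + δ₂ * w.2 ^ 2)) else 0))) +
        ε * (quadraticChar k (c₀ * (δ₁ * α * w.1 ^ 2 + 2 * δ₁ * b * w.1 * w.2 + δ₂ * γ * w.2 ^ 2)) +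
          quadraticChar k (c₀ * (δ₁ * α * w.1 ^ 2 + 2 * δ₁ * b * w.1 * w.2 + δ₂ * γ * w.2 ^ 2)) *
            quadraticChar k (-δ₀⁻¹ * (δ₁ * w.1 ^ 2 + δ₂ * w.2 ^ 2))) := fun w => by
    rw [two_mul_ite_quadraticChar_eq _ _ hε, quadraticChar_mul_sq_eq hc₀]
    split_ifs <;> ring
  simp_rw [hpt]
  rw [Finset.sum_add_distrib, Finset.sum_add_distrib, Finset.sum_sub_distrib, Finset.sum_sub_distrib, ← Finset.mul_sum, Finset.sum_add_distrib,
    Finset.sum_const, nsmul_eq_mul, mul_one, card_filter_ne_zero_prod_eq,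
    sum_ite_value_eq_zero_one' hk hδ₁ hδ₂ hbb hirr, sum_quadraticChar_norm_eq_zero hk hδ₁ hδ₂ (-δ₀⁻¹),
    sum_ite_value_eq_zero_quadraticChar_norm' hk hδ₁ hδ₂ hbb hirr hm, sum_quadraticChar_value_eq_zero' hk hδ₁ hδ₂ hbb hirr c₀,
    sum_quadraticChar_value_mul_quadraticChar_norm' hk hδ₀ hδ₁ hδ₂ hbb hirr c₀]
  ring

/-! ## §2 Matrix currency and `J̄₀`-frame for a general block -/

/-- Three pairwise distinct indices exhaust `Fin 3` (private index plumbing). [folklore] -/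
private theorem fin_three_eq_or_of_distinct'' (i₀ j l m : Fin 3) (hij : i₀ ≠ j) (hil : i₀ ≠ l) (hjl : j ≠ l) : m = i₀ ∨ m = j ∨ m = l := by
  revert i₀ j l m hij hil hjl
  decide

/-- `Σ_m f m = f i₀ + f j + f l` for pairwise distinct `i₀, j, l : Fin 3` (private index plumbing). [folklore] -/
private theorem sum_univ_fin_three_of_distinct'' {β : Type*} [AddCommMonoid β] (f : Fin 3 → β) {i₀ j l : Fin 3} (hij : i₀ ≠ j) (hil : i₀ ≠ l) (hjl : j ≠ l) :
    ∑ m, f m = f i₀ + f j + f l := by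
  have huniv : (univ : Finset (Fin 3)) = {i₀, j, l} := by
    ext m
    simp only [Finset.mem_univ, Finset.mem_insert, Finset.mem_singleton, true_iff]
    exact fin_three_eq_or_of_distinct'' i₀ j l m hij hil hjl
  rw [huniv, Finset.sum_insert (by simp [hij, hil]), Finset.sum_insert (by simp [hjl]), Finset.sum_singleton, add_assoc]

/-- **MATRIX CURRENCY, general block.**  For a self-adjoint block `B` (zeros against the isolated index `i₀`, `δ_jB_{jl} = δ_lB_{lj}`; NO centring) and ANY predicate `R`:
`#{w ≠ 0 : ᵗw·diag(δ)·w = 0 ∧ R(ᵗw·diag(δ)B·w)} = #{v ≠ 0 : δ_{i₀}v.1² + δ_jv.2.1² + δ_lv.2.2² = 0 ∧ R(T(v.2))}`,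
`T(X,Y) = δ_j(B_{jj} − B_{i₀i₀})X² + 2δ_jB_{jl}XY + δ_l(B_{ll} − B_{i₀i₀})Y²` — on the cone the scalar part `B_{i₀i₀}·(cone)` drops.
[cite: Rogawski1990, §4.9 Prop. 4.9.1 p. 55] [cite: Kottwitz1986, §3] -/
theorem card_iso_blockFrame_pred_eq_card_prod' {i₀ j l : Fin 3} (hij : i₀ ≠ j) (hil : i₀ ≠ l) (hjl : j ≠ l)
    (δ : Fin 3 → k) (B : Matrix (Fin 3) (Fin 3) k) (hB₁ : B i₀ j = 0) (hB₂ : B i₀ l = 0) (hB₃ : B j i₀ = 0) (hB₄ : B l i₀ = 0)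
    (hadj : δ j * B j l = δ l * B l j) (R : k → Prop) [DecidablePred R] :
    (univ.filter fun w : Fin 3 → k => w ≠ 0 ∧ w ⬝ᵥ (diagonal δ *ᵥ w) = 0 ∧ R (w ⬝ᵥ ((diagonal δ * B) *ᵥ w))).card =
      (univ.filter fun v : k × k × k => v ≠ 0 ∧ δ i₀ * v.1 ^ 2 + δ j * v.2.1 ^ 2 + δ l * v.2.2 ^ 2 = 0 ∧
        R (δ j * (B j j - B i₀ i₀) * v.2.1 ^ 2 + 2 * δ j * B j l * v.2.1 * v.2.2 + δ l * (B l l - B i₀ i₀) * v.2.2 ^ 2)).card := by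
  have hcongr : (univ.filter fun w : Fin 3 → k => w ≠ 0 ∧ w ⬝ᵥ (diagonal δ *ᵥ w) = 0 ∧ R (w ⬝ᵥ ((diagonal δ * B) *ᵥ w))) =
      univ.filter fun w : Fin 3 → k => ¬ (w i₀ = 0 ∧ w j = 0 ∧ w l = 0) ∧ δ i₀ * w i₀ ^ 2 + δ j * w j ^ 2 + δ l * w l ^ 2 = 0 ∧
        R (δ j * (B j j - B i₀ i₀) * w j ^ 2 + 2 * δ j * B j l * w j * w l + δ l * (B l l - B i₀ i₀) * w l ^ 2) := by
    refine Finset.filter_congr fun w _ => ?_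
    have h0 : w ≠ 0 ↔ ¬ (w i₀ = 0 ∧ w j = 0 ∧ w l = 0) := by
      refine not_congr ⟨fun h => by simp [h], fun h => funext fun m => ?_⟩
      rcases fin_three_eq_or_of_distinct'' i₀ j l m hij hil hjl with rfl | rfl | rfl
      exacts [h.1, h.2.1, h.2.2]
    have hcone : w ⬝ᵥ (diagonal δ *ᵥ w) = δ i₀ * w i₀ ^ 2 + δ j * w j ^ 2 + δ l * w l ^ 2 := by
      rw [dotProduct_diagonal_mulVec_self, sum_univ_fin_three_of_distinct'' _ hij hil hjl]
    have hval : w ⬝ᵥ ((diagonal δ * B) *ᵥ w) = δ i₀ * B i₀ i₀ * w i₀ ^ 2 + δ j * B j j * w j ^ 2 + δ j * B j l * w j * w l +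
        δ l * B l j * w l * w j + δ l * B l l * w l ^ 2 := by
      rw [dotProduct_diagonal_mul_mulVec_self, sum_univ_fin_three_of_distinct'' _ hij hil hjl, sum_univ_fin_three_of_distinct'' _ hij hil hjl,
        sum_univ_fin_three_of_distinct'' _ hij hil hjl, sum_univ_fin_three_of_distinct'' _ hij hil hjl, hB₁, hB₂, hB₃, hB₄]
      ring
    rw [h0, hcone, hval]
    refine and_congr_right fun _ => and_congr_right fun hc => ?_
    rw [show δ i₀ * B i₀ i₀ * w i₀ ^ 2 + δ j * B j j * w j ^ 2 + δ j * B j l * w j * w l + δ l * B l j * w l * w j + δ l * B l l * w l ^ 2 =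
      δ j * (B j j - B i₀ i₀) * w j ^ 2 + 2 * δ j * B j l * w j * w l + δ l * (B l l - B i₀ i₀) * w l ^ 2 by
        linear_combination (B i₀ i₀) * hc - (w j * w l) * hadj]
  rw [hcongr, card_filter_fin_three_coords_eq hij hil hjl
    (fun x y z => ¬ (x = 0 ∧ y = 0 ∧ z = 0) ∧ δ i₀ * x ^ 2 + δ j * y ^ 2 + δ l * z ^ 2 = 0 ∧
      R (δ j * (B j j - B i₀ i₀) * y ^ 2 + 2 * δ j * B j l * y * z + δ l * (B l l - B i₀ i₀) * z ^ 2))]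
  exact congrArg Finset.card (Finset.filter_congr fun v _ =>
    and_congr_left fun _ => not_congr ⟨fun h => Prod.ext h.1 (Prod.ext h.2.1 h.2.2), fun h => by simp [h]⟩)

/-- **`J̄₀`-CURRENCY, general block**: with `ᵗĀ·J̄₀·Ā = diag(δ)` and `Ā⁻¹·Ȳ·Ā = B` (self-adjoint block, no centring), for ANY predicate `R`
`#{x ≠ 0 : ᵗxJ̄₀x = 0 ∧ R(ᵗx(J̄₀Ȳ)x)} = #{v ≠ 0 : δ_{i₀}v.1² + δ_jv.2.1² + δ_lv.2.2² = 0 ∧ R(T(v.2))}` (★ frame change `x = Āw`).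
[cite: Rogawski1990, §4.9 Prop. 4.9.1 p. 55] [cite: Kottwitz1986, §3] -/
theorem ncard_iso_antidiagonal_block_pred_eq_of_frame' {i₀ j l : Fin 3} (hij : i₀ ≠ j) (hil : i₀ ≠ l) (hjl : j ≠ l)
    (δ : Fin 3 → k) (B : Matrix (Fin 3) (Fin 3) k) (hB₁ : B i₀ j = 0) (hB₂ : B i₀ l = 0) (hB₃ : B j i₀ = 0) (hB₄ : B l i₀ = 0)
    (hadj : δ j * B j l = δ l * B l j)
    (A : GL (Fin 3) k) (Y : Matrix (Fin 3) (Fin 3) k)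
    (hG : ((A : Matrix (Fin 3) (Fin 3) k))ᵀ * ((StdForm.antidiagonal 3).over k) * (A : Matrix (Fin 3) (Fin 3) k) = diagonal δ)
    (hY : ((A⁻¹ : GL (Fin 3) k) : Matrix (Fin 3) (Fin 3) k) * Y * (A : Matrix (Fin 3) (Fin 3) k) = B)
    (R : k → Prop) [DecidablePred R] :
    {x : Fin 3 → k | x ≠ 0 ∧ x ⬝ᵥ (((StdForm.antidiagonal 3).over k) *ᵥ x) = 0 ∧ R (x ⬝ᵥ ((((StdForm.antidiagonal 3).over k) * Y) *ᵥ x))}.ncard =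
      (univ.filter fun v : k × k × k => v ≠ 0 ∧ δ i₀ * v.1 ^ 2 + δ j * v.2.1 ^ 2 + δ l * v.2.2 ^ 2 = 0 ∧
        R (δ j * (B j j - B i₀ i₀) * v.2.1 ^ 2 + 2 * δ j * B j l * v.2.1 * v.2.2 + δ l * (B l l - B i₀ i₀) * v.2.2 ^ 2)).card := by
  have h := ncard_setOf_ne_zero_congr_frame_eq A ((StdForm.antidiagonal 3).over k) Y (fun s t => s = 0 ∧ R t)
  simp only [hG, hY] at h
  rw [← h, ← Finset.coe_filter_univ, Set.ncard_coe_finset]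
  exact card_iso_blockFrame_pred_eq_card_prod' hij hil hjl δ B hB₁ hB₂ hB₃ hB₄ hadj R

/-! ## §3 The ROOT LINE CENSUS of a type-(2) root with a general block (normalised-parameter currency) -/

/-- **PARAMETER CURRENCY, general block** (★ `card_sub_one_mul_natCard_params_eq_ncard`): for `R` invariant under non-zero squares,
`(q − 1)·#{p : R(Q_Ȳ(x̄_p))} = #{v ≠ 0 : δ_{i₀}v.1² + δ_jv.2.1² + δ_lv.2.2² = 0 ∧ R(T(v.2))}`. [cite: Rogawski1990, §4.9 Prop. 4.9.1 p. 55] [cite: Kottwitz1986, §3] -/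
theorem card_sub_one_mul_natCard_params_blockFrame_pred_eq' {i₀ j l : Fin 3} (hij : i₀ ≠ j) (hil : i₀ ≠ l) (hjl : j ≠ l)
    (δ : Fin 3 → k) (B : Matrix (Fin 3) (Fin 3) k) (hB₁ : B i₀ j = 0) (hB₂ : B i₀ l = 0) (hB₃ : B j i₀ = 0) (hB₄ : B l i₀ = 0)
    (hadj : δ j * B j l = δ l * B l j)
    (A : GL (Fin 3) k) (Y : Matrix (Fin 3) (Fin 3) k)
    (hG : ((A : Matrix (Fin 3) (Fin 3) k))ᵀ * ((StdForm.antidiagonal 3).over k) * (A : Matrix (Fin 3) (Fin 3) k) = diagonal δ)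
    (hY : ((A⁻¹ : GL (Fin 3) k) : Matrix (Fin 3) (Fin 3) k) * Y * (A : Matrix (Fin 3) (Fin 3) k) = B)
    (R : k → Prop) [DecidablePred R] (hR : ∀ c t : k, c ≠ 0 → (R (c * c * t) ↔ R t)) :
    ((Fintype.card k : ℤ) - 1) * (Nat.card {p : Option {p : k × k // p.2 + (RingHom.id k) p.2 + p.1 * (RingHom.id k) p.1 = 0} //
        R ((p.elim (Pi.single 2 1) fun q => ![(1 : k), q.1.1, q.1.2]) ⬝ᵥ
          (((((StdForm.antidiagonal 3).over k) * Y) *ᵥ (p.elim (Pi.single 2 1) fun q => ![(1 : k), q.1.1, q.1.2]))))} : ℕ) =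
      ((univ.filter fun v : k × k × k => v ≠ 0 ∧ δ i₀ * v.1 ^ 2 + δ j * v.2.1 ^ 2 + δ l * v.2.2 ^ 2 = 0 ∧
        R (δ j * (B j j - B i₀ i₀) * v.2.1 ^ 2 + 2 * δ j * B j l * v.2.1 * v.2.2 + δ l * (B l l - B i₀ i₀) * v.2.2 ^ 2)).card : ℤ) := by
  have hmul := card_sub_one_mul_natCard_params_eq_ncard Y R hR
  rw [ncard_iso_antidiagonal_block_pred_eq_of_frame' hij hil hjl δ B hB₁ hB₂ hB₃ hB₄ hadj A Y hG hY R] at hmul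
  have hq : (Nat.card k : ℤ) = Fintype.card k := by rw [Nat.card_eq_fintype_card]
  have h := congrArg (Nat.cast : ℕ → ℤ) hmul
  rw [Nat.cast_mul, Nat.cast_sub (Nat.one_le_iff_ne_zero.2 (Nat.card_pos (α := k)).ne'), hq, Nat.cast_one] at h
  exact h

/-- **ROOT LINE CENSUS, TYPE-(2) ROOT WITH A GENERAL BLOCK — NULL LINES: `#{p : Q_Ȳ(x̄_p) = 0} = 1 + χ(δ_jδ_l·(B_{jl}B_{lj} − (B_{jj} − B_{i₀i₀})(B_{ll} − B_{i₀i₀})))`**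
= `1 + χ(−δ_jδ_l·det B̄'_W)`: a hyperbolic root plane (`χ(−δ_jδ_l) = +1`) carries `2` null root lines iff `det B̄'_W` is a square, an anisotropic one iff it is a
non-square (chair RULING (17)(ii)).  (Statement-first v2 head, verbatim.) [cite: Rogawski1990, §4.9 Prop. 4.9.1 p. 55] [cite: Kottwitz1986, §3] -/
theorem natCard_params_blockFrame_null_eq' (hk : ringChar k ≠ 2) {i₀ j l : Fin 3} (hij : i₀ ≠ j) (hil : i₀ ≠ l) (hjl : j ≠ l)
    (δ : Fin 3 → k) (hδ : ∀ m, δ m ≠ 0) (B : Matrix (Fin 3) (Fin 3) k)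
    (hB₁ : B i₀ j = 0) (hB₂ : B i₀ l = 0) (hB₃ : B j i₀ = 0) (hB₄ : B l i₀ = 0)
    (hadj : δ j * B j l = δ l * B l j)
    (hirr : quadraticChar k ((B j j - B l l) ^ 2 + 4 * (B j l * B l j)) = -1)
    (A : GL (Fin 3) k) (Y : Matrix (Fin 3) (Fin 3) k)
    (hG : ((A : Matrix (Fin 3) (Fin 3) k))ᵀ * ((StdForm.antidiagonal 3).over k) * (A : Matrix (Fin 3) (Fin 3) k) = diagonal δ)
    (hY : ((A⁻¹ : GL (Fin 3) k) : Matrix (Fin 3) (Fin 3) k) * Y * (A : Matrix (Fin 3) (Fin 3) k) = B) :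
    ((Nat.card {p : Option {p : k × k // p.2 + (RingHom.id k) p.2 + p.1 * (RingHom.id k) p.1 = 0} //
        (p.elim (Pi.single 2 1) fun q => ![(1 : k), q.1.1, q.1.2]) ⬝ᵥ
          (((((StdForm.antidiagonal 3).over k) * Y) *ᵥ (p.elim (Pi.single 2 1) fun q => ![(1 : k), q.1.1, q.1.2]))) = 0} : ℕ) : ℤ) =
      1 + quadraticChar k (δ j * δ l * (B j l * B l j - (B j j - B i₀ i₀) * (B l l - B i₀ i₀))) := by
  have hq1 : (Fintype.card k : ℤ) - 1 ≠ 0 := by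
    have : 1 < Fintype.card k := Fintype.one_lt_card
    omega
  have hirr' : quadraticChar k (((B j j - B i₀ i₀) - (B l l - B i₀ i₀)) ^ 2 + 4 * (B j l * B l j)) = -1 := by
    rw [show (B j j - B i₀ i₀) - (B l l - B i₀ i₀) = B j j - B l l by ring]; exact hirr
  have h := card_sub_one_mul_natCard_params_blockFrame_pred_eq' hij hil hjl δ B hB₁ hB₂ hB₃ hB₄ hadj A Y hG hY (fun t => t = 0) (fun c t hc => by simp [hc])
  rw [card_iso_blockFrame_prod_null_eq' hk (hδ i₀) (hδ j) (hδ l) hadj hirr'] at h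
  exact mul_left_cancel₀ hq1 h

/-- **ROOT LINE CENSUS, TYPE-(2) ROOT WITH A GENERAL BLOCK — CLASS LINES (doubled):
`2·#{p : χ(c₀·Q_Ȳ(x̄_p)) = ε} = q − χ(δ_jδ_l·(B_{jl}B_{lj} − (B_{jj} − B_{i₀i₀})(B_{ll} − B_{i₀i₀}))) + ε·χ(2c₀δ_{i₀}δ_jδ_l)·Σ_v χ(v + (B_{jj} + B_{ll} − 2B_{i₀i₀}))·χ(v² − disc)`**,
`disc = (B_{jj} − B_{ll})² + 4B_{jl}B_{lj}` (`c₀ ≠ 0`, `ε = ±1`).  The signed class sum `#₊ − #₋` is `χ(2c₀δ_{i₀}δ_jδ_l)·J(τ, disc)` — the CROSS LAW of RULING (17)(iv)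
for two roots with the same `(τ, disc)` and class key.  (Statement-first v2 head, verbatim.)
[cite: Rogawski1990, §4.9 Prop. 4.9.1 p. 55] [cite: Kottwitz1986, §3] [cite: LidlNiederreiter1996, Def. 5.49] -/
theorem two_mul_natCard_params_blockFrame_quadraticChar_eq' (hk : ringChar k ≠ 2) {i₀ j l : Fin 3} (hij : i₀ ≠ j) (hil : i₀ ≠ l) (hjl : j ≠ l)
    (δ : Fin 3 → k) (hδ : ∀ m, δ m ≠ 0) (B : Matrix (Fin 3) (Fin 3) k)
    (hB₁ : B i₀ j = 0) (hB₂ : B i₀ l = 0) (hB₃ : B j i₀ = 0) (hB₄ : B l i₀ = 0)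
    (hadj : δ j * B j l = δ l * B l j)
    (hirr : quadraticChar k ((B j j - B l l) ^ 2 + 4 * (B j l * B l j)) = -1)
    (A : GL (Fin 3) k) (Y : Matrix (Fin 3) (Fin 3) k)
    (hG : ((A : Matrix (Fin 3) (Fin 3) k))ᵀ * ((StdForm.antidiagonal 3).over k) * (A : Matrix (Fin 3) (Fin 3) k) = diagonal δ)
    (hY : ((A⁻¹ : GL (Fin 3) k) : Matrix (Fin 3) (Fin 3) k) * Y * (A : Matrix (Fin 3) (Fin 3) k) = B)
    (c₀ : k) (hc₀ : c₀ ≠ 0) {ε : ℤ} (hε : ε = 1 ∨ ε = -1) :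
    2 * ((Nat.card {p : Option {p : k × k // p.2 + (RingHom.id k) p.2 + p.1 * (RingHom.id k) p.1 = 0} //
        quadraticChar k (c₀ * ((p.elim (Pi.single 2 1) fun q => ![(1 : k), q.1.1, q.1.2]) ⬝ᵥ
          (((((StdForm.antidiagonal 3).over k) * Y) *ᵥ (p.elim (Pi.single 2 1) fun q => ![(1 : k), q.1.1, q.1.2]))))) = ε} : ℕ) : ℤ) =
      Fintype.card k - quadraticChar k (δ j * δ l * (B j l * B l j - (B j j - B i₀ i₀) * (B l l - B i₀ i₀))) +
        ε * quadraticChar k (2 * c₀ * δ i₀ * δ j * δ l) *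
          ∑ v : k, quadraticChar k (v + (B j j + B l l - 2 * B i₀ i₀)) * quadraticChar k (v ^ 2 - ((B j j - B l l) ^ 2 + 4 * (B j l * B l j))) := by
  have hq1 : (Fintype.card k : ℤ) - 1 ≠ 0 := by
    have : 1 < Fintype.card k := Fintype.one_lt_card
    omega
  have hirr' : quadraticChar k (((B j j - B i₀ i₀) - (B l l - B i₀ i₀)) ^ 2 + 4 * (B j l * B l j)) = -1 := by
    rw [show (B j j - B i₀ i₀) - (B l l - B i₀ i₀) = B j j - B l l by ring]; exact hirr
  have hP : ∀ c t : k, c ≠ 0 → (quadraticChar k (c₀ * (c * c * t)) = ε ↔ quadraticChar k (c₀ * t) = ε) := fun c t hc => by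
    rw [show c₀ * (c * c * t) = c₀ * t * c ^ 2 by ring, map_mul, map_pow, quadraticChar_sq_one hc, mul_one]
  have h1 := card_sub_one_mul_natCard_params_blockFrame_pred_eq' hij hil hjl δ B hB₁ hB₂ hB₃ hB₄ hadj A Y hG hY (fun t => quadraticChar k (c₀ * t) = ε) hP
  have h2 := two_mul_card_iso_blockFrame_prod_quadraticChar_eq' hk (hδ i₀) (hδ j) (hδ l) hadj hirr' hc₀ hε
  rw [show (B j j - B i₀ i₀) - (B l l - B i₀ i₀) = B j j - B l l by ring, show (B j j - B i₀ i₀) + (B l l - B i₀ i₀) = B j j + B l l - 2 * B i₀ i₀ by ring] at h2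
  refine mul_left_cancel₀ hq1 ?_
  linear_combination 2 * h1 + h2

end Literature.NumberTheory.Rogawski1990.TypeTwoBlockRoot
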